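import Literature.Geometry.Lorentzian.KerrNullRadialPotential
import HarnessLib

/-!
# Turning points of null geodesics of Kerr change type exactly across the photon shell

(family `gr`; namespace `Literature.Geometry.Lorentzian.Kerr`; built on
`KerrNullRadialPotential.lean` — the null radial Carter potential `R`, Θ-admissibility, the
factorisation `ΔR′ = 2PG` at a root, the photon radii `r_ph⁻ = photonOrbitRadius M |a| ∈
[3M, 4M]` (retrograde) and `r_ph⁺ = photonOrbitRadius M (−|a|) ∈ (M, 3M]` (prograde), and the
sign of Sbierski's cubic `q(c) = c(c − 3M)² − 4Ma²` off the shell.)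

For sub-extremal Kerr `(M, a)`, `|a| < M`, this file PROVES the turning-point dichotomy that
underlies the trapping structure of Kerr null geodesics (the trapped ones project into the photon
shell `[r_ph⁺, r_ph⁻]`; Wilkins 1972, Teo 2003, and in the high-frequency guise
Dafermos–Rodnianski–Shlapentokh-Rothman 2016, §6 — cf. `KerrSeparatedTrapping.lean`):

* `Kerr.deriv_nullRadialPotential_pos_of_photonOrbitRadius_lt` — **every Θ-admissible tangency
  beyond the retrograde photon radius is a pericentre**: `R(c) = 0`, `c > r_ph⁻`,
  `(E, L, Q) ≠ 0` admissible `⇒ R′(c) > 0`;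
* `Kerr.deriv_nullRadialPotential_neg_of_lt_photonOrbitRadius_neg` — **every Θ-admissible
  tangency strictly between the event horizon and the prograde photon radius is an apocentre**:
  `r₊ < c < r_ph⁺ ⇒ R′(c) < 0` (all Killing energies, the ergoregion included).

In Ionescu–Klainerman's language (arXiv:1108.3575, Def. 1.1) these say that the cylinders
`{r = c}` of exact Kerr are strongly null pseudo-convex towards `{r > c}` for `c > r_ph⁻` and
towards `{r < c}` for `r₊ < c < r_ph⁺`.

Proof (elementary real algebra, recorded because no source prints it in this form): at a root `c`
with `Δ(c) > 0` put `s = L − aE`, `P = Ec² − as`, `G = Ec(c² − 3Mc + 2a²) + (c − M)as`, so that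
`ΔR′(c) = 2PG`. For `E = 0` admissibility forces `Q ≥ 0`, `R′ = −Δ′(Q + L²) < 0`, and a root has
`Δ(c) ≤ a²`, i.e. `c ≤ 2M`. For `E ≠ 0` one may take `E > 0` (`(E, L) ↦ (−E, −L)` is a
symmetry). If `|L| < |a|E` then `−a²E < aL < a²E` and the signs of `P`, `G` are read off directly
(`c² − 3Mc + 2a² < 0` on `(r₊, r_ph⁺)` because `q(c) = (c − 3M)(c² − 3Mc + 2a²) − 2a²(c − M) > 0`
there). If `|L| ≥ |a|E` then `Q ≥ 0`, i.e. `N := E²c³ − 2acEs − (c − 2M)s² ≥ 0` (`ΔQ = cN`);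
with `A = c(c² − 3Mc + 2a²)`, `B = (c − M)a` the quadratic `Ñ(t) = B²E²c³ − 2acEBt − (c − 2M)t²`
has `Ñ(Bs) = B²N ≥ 0`, `Bs − (−EA) = G`, `(c − M)Ec² − Bs = (c − M)P`, and
`Ñ(−EA) = −E²c²Δq(c)`, `Ñ′(−EA) = 2Ec(c − 3M)Δ`, `Ñ((c − M)Ec²) = −(c − M)²E²c³Δ`; concavity of
`Ñ` for `c ≥ 2M` (tangent bound at `−EA`) and convexity for `c ≤ 2M` (chord bound on
`[−EA, (c − M)Ec²]`) exclude `G ≤ 0` beyond `r_ph⁻` and `G ≥ 0 ∧ P > 0` below `r_ph⁺`, while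
`P ≤ 0` is impossible beyond `2M` and gives `G > 2EcΔ > 0` (hence `R′ < 0`) below; `P = 0` at a
root would force `K = Q + s² = 0`, excluded for non-trivial admissible constants.

Not here: the geometric reading (pseudo-convexity of the cylinders in a spacetime `C²`-close to
Kerr, bicharacteristics), and the shell `r_ph⁺ ≤ c ≤ r_ph⁻` itself, where both signs occur.

## References

* D. C. Wilkins, Phys. Rev. D 5 (1972) 814–822 (key `Wilkins1972`: bound null orbits).
* J. M. Bardeen, W. H. Press, S. A. Teukolsky, ApJ 178 (1972) 347, §II
  (key `BardeenPressTeukolsky1972`).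
* B. Carter, Commun. Math. Phys. 10 (1968) 280–310, §4 (key `Carter1968`).
* J. Sbierski, Anal. PDE 8 (2015), §7A (key `Sbierski2015`).
-/

noncomputable section

open Real

namespace Literature.Geometry.Lorentzian.Kerr

/-! ### The dichotomy -/

/-- **Every Θ-admissible null tangency beyond the retrograde photon radius is a pericentre.**
For `0 < M`, `|a| < M`, non-trivial Θ-admissible constants `(E, L, Q)` and a root `c` of the null
radial potential with `c > r_ph⁻ = photonOrbitRadius M |a|` (`∈ [3M, 4M]`): `R′(c) > 0`. In
Ionescu–Klainerman's language: every cylinder `{r = c}`, `c > r_ph⁻`, of exact Kerr is strongly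
null pseudo-convex towards `{r > c}`. The binding case is the retrograde equatorial tangency
(`Q = 0`, `aL < 0`), where `R′/c³ → 0⁺` as `c → r_ph⁻`. [folklore] -/
theorem deriv_nullRadialPotential_pos_of_photonOrbitRadius_lt {M a E L Q c : ℝ} (hM : 0 < M)
    (ha : |a| < M) (hc : photonOrbitRadius M |a| < c) (hadm : NullThetaAdmissible a E L Q)
    (hne : E ≠ 0 ∨ L ≠ 0 ∨ Q ≠ 0) (hroot : nullRadialPotential M a E L Q c = 0) :
    0 < deriv (nullRadialPotential M a E L Q) c := by
  have hc3 : 3 * M < c := lt_of_le_of_lt (photonOrbitRadius_mem hM (abs_nonneg a)).1 hc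
  have hq : 0 < c * (c - 3 * M) ^ 2 - 4 * M * a ^ 2 :=
    photonCubic_pos_of_photonOrbitRadius_lt hM ha.le hc
  have ha2 : a ^ 2 < M ^ 2 := by
    have h1 : |a| ^ 2 < M ^ 2 := pow_lt_pow_left₀ ha (abs_nonneg a) two_ne_zero
    rwa [sq_abs] at h1
  have hc0 : 0 < c := by linarith
  have hΔ : 0 < c ^ 2 - 2 * M * c + a ^ 2 := by nlinarith
  -- the symmetry `(E, L) ↦ (−E, −L)` lets us take `E ≥ 0`
  wlog hE : 0 ≤ E generalizing E L
  · have h := this (E := -E) (L := -L) (nullThetaAdmissible_neg_neg hadm)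
      (by rcases hne with h | h | h <;> simp [h]) (by rwa [nullRadialPotential_neg_neg])
      (by linarith)
    rwa [nullRadialPotential_neg_neg] at h
  rcases hE.eq_or_lt with hE0 | hEpos
  · -- `E = 0`: admissibility gives `Q ≥ 0`, and then a root forces `Δ(c) ≤ a²`, i.e. `c ≤ 2M`
    subst hE0
    exfalso
    have hQ : 0 ≤ Q := hadm.carter_nonneg (by simpa using sq_nonneg L)
    have hK : 0 < Q + L ^ 2 := by
      rcases hne with h | h | h
      · exact absurd rfl h
      · have : 0 < L ^ 2 := lt_of_le_of_ne (sq_nonneg L) (Ne.symm (pow_ne_zero 2 h))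
        linarith
      · have : 0 < Q := lt_of_le_of_ne hQ (Ne.symm h)
        nlinarith [sq_nonneg L]
    unfold nullRadialPotential at hroot
    nlinarith [mul_nonneg (sq_nonneg a) hQ,
      mul_pos (mul_pos hc0 (by linarith : (0 : ℝ) < c - 2 * M)) hK]
  · -- `E > 0`: `Δ R′ = 2PG` and both `P`, `G` are positive
    have key := delta_mul_deriv_nullRadialPotential_of_eq_zero hroot
    suffices hPG : 0 < E * c ^ 2 - a * (L - a * E) ∧
        0 < E * c * (c ^ 2 - 3 * M * c + 2 * a ^ 2) + (c - M) * a * (L - a * E) by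
      have h2 : 0 < (c ^ 2 - 2 * M * c + a ^ 2) * deriv (nullRadialPotential M a E L Q) c := by
        rw [key]; exact mul_pos (mul_pos two_pos hPG.1) hPG.2
      exact lt_of_mul_lt_mul_left (by rw [mul_zero]; exact h2) hΔ.le
    rcases lt_or_ge |L| (|a| * E) with hv | hnv
    · -- vortical-capable constants: `−a²E < aL < a²E`, signs read off directly
      rcases eq_or_ne a 0 with ha0 | ha0
      · subst ha0; simp at hv; linarith [abs_nonneg L]
      have h1 : |a| * |L| < |a| * (|a| * E) := mul_lt_mul_of_pos_left hv (abs_pos.2 ha0)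
      rw [← abs_mul, ← mul_assoc, abs_mul_abs_self, ← sq] at h1
      obtain ⟨haL1, haL2⟩ := abs_lt.1 h1
      constructor
      · nlinarith
      · nlinarith [mul_pos (by linarith : (0 : ℝ) < c - M) (by linarith : 0 < a * L + a ^ 2 * E),
          mul_nonneg hE (add_nonneg (mul_nonneg (sq_nonneg c) (by linarith : (0 : ℝ) ≤ c - 3 * M))
            (by positivity : (0 : ℝ) ≤ 2 * a ^ 2 * M))]
    · -- `L² ≥ a²E²`: `Q ≥ 0`, hence `N ≥ 0`; tangent bound for the concave quadratic `Ñ`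
      have hQ : 0 ≤ Q := by
        refine hadm.carter_nonneg ?_
        have h1 : (|a| * E) ^ 2 ≤ |L| ^ 2 := pow_le_pow_left₀ (by positivity) hnv 2
        rwa [mul_pow, sq_abs, sq_abs] at h1
      have hN : 0 ≤ E ^ 2 * c ^ 3 - 2 * a * c * E * (L - a * E) - (c - 2 * M) * (L - a * E) ^ 2 := by
        have e : c * (E ^ 2 * c ^ 3 - 2 * a * c * E * (L - a * E) - (c - 2 * M) * (L - a * E) ^ 2) =
            (c ^ 2 - 2 * M * c + a ^ 2) * Q := by
          unfold nullRadialPotential at hroot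
          linear_combination hroot
        have : c * 0 ≤ c * (E ^ 2 * c ^ 3 - 2 * a * c * E * (L - a * E) -
            (c - 2 * M) * (L - a * E) ^ 2) := by
          rw [mul_zero, e]; exact mul_nonneg hΔ.le hQ
        exact le_of_mul_le_mul_left this hc0
      have hP : 0 < E * c ^ 2 - a * (L - a * E) := by
        by_contra h
        push Not at h
        nlinarith [mul_nonneg (mul_nonneg hc0.le hEpos.le) (sub_nonneg.2 h),
          mul_nonneg (by linarith : (0 : ℝ) ≤ c - 2 * M) (sq_nonneg (L - a * E)),
          pow_pos hc0 3, mul_pos (pow_pos hEpos 2) (pow_pos hc0 3)]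
      refine ⟨hP, ?_⟩
      by_contra h
      push Not at h
      -- `B²N = −E²c²Δq + 2Ec(c − 3M)Δ·G − (c − 2M)G²` (Taylor expansion of `Ñ` at `t₀ = −EA`)
      have expand : ((c - M) * a) ^ 2 *
            (E ^ 2 * c ^ 3 - 2 * a * c * E * (L - a * E) - (c - 2 * M) * (L - a * E) ^ 2) =
          -(E ^ 2 * c ^ 2 * (c ^ 2 - 2 * M * c + a ^ 2) * (c * (c - 3 * M) ^ 2 - 4 * M * a ^ 2)) +
          2 * E * c * (c - 3 * M) * (c ^ 2 - 2 * M * c + a ^ 2) *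
            (E * c * (c ^ 2 - 3 * M * c + 2 * a ^ 2) + (c - M) * a * (L - a * E)) -
          (c - 2 * M) * (E * c * (c ^ 2 - 3 * M * c + 2 * a ^ 2) + (c - M) * a * (L - a * E)) ^ 2 := by
        ring
      have hB2N := mul_nonneg (sq_nonneg ((c - M) * a)) hN
      have hcore : 0 < E ^ 2 * c ^ 2 * (c ^ 2 - 2 * M * c + a ^ 2) *
          (c * (c - 3 * M) ^ 2 - 4 * M * a ^ 2) :=
        mul_pos (mul_pos (mul_pos (pow_pos hEpos 2) (pow_pos hc0 2)) hΔ) hq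
      have hterm : 2 * E * c * (c - 3 * M) * (c ^ 2 - 2 * M * c + a ^ 2) *
          (E * c * (c ^ 2 - 3 * M * c + 2 * a ^ 2) + (c - M) * a * (L - a * E)) ≤ 0 :=
        mul_nonpos_of_nonneg_of_nonpos
          (mul_nonneg (mul_nonneg (by positivity) (by linarith)) hΔ.le) h
      have hsq : 0 ≤ (c - 2 * M) *
          (E * c * (c ^ 2 - 3 * M * c + 2 * a ^ 2) + (c - M) * a * (L - a * E)) ^ 2 :=
        mul_nonneg (by linarith) (sq_nonneg _)
      linarith

/-- **Every Θ-admissible null tangency strictly between the event horizon and the prograde photon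
radius is an apocentre.** For `0 < M`, `|a| < M`, non-trivial Θ-admissible `(E, L, Q)` and a root
`c` of the null radial potential with `r₊ < c < r_ph⁺ = photonOrbitRadius M (−|a|)` (`∈ (M, 3M]`):
`R′(c) < 0` — for every Killing energy, the zero- and negative-energy (ergoregion) geodesics
included; i.e. the cylinders `{r = c}`, `r₊ < c < r_ph⁺`, of exact Kerr are strongly null
pseudo-convex towards `{r < c}`. The binding case is the prograde equatorial tangency.
[folklore] -/
theorem deriv_nullRadialPotential_neg_of_lt_photonOrbitRadius_neg {M a E L Q c : ℝ}
    (hM : 0 < M) (ha : |a| < M) (hc₁ : rPlus M a < c) (hc₂ : c < photonOrbitRadius M (-|a|))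
    (hadm : NullThetaAdmissible a E L Q) (hne : E ≠ 0 ∨ L ≠ 0 ∨ Q ≠ 0)
    (hroot : nullRadialPotential M a E L Q c = 0) :
    deriv (nullRadialPotential M a E L Q) c < 0 := by
  have ha2 : a ^ 2 < M ^ 2 := by
    have h1 : |a| ^ 2 < M ^ 2 := pow_lt_pow_left₀ ha (abs_nonneg a) two_ne_zero
    rwa [sq_abs] at h1
  have hS0 : 0 ≤ √(M ^ 2 - a ^ 2) := sqrt_nonneg _
  have hS2 : √(M ^ 2 - a ^ 2) ^ 2 = M ^ 2 - a ^ 2 := sq_sqrt (by linarith)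
  have hcM : √(M ^ 2 - a ^ 2) < c - M := by unfold rPlus at hc₁; linarith
  have hMc : M < c := by linarith
  have hΔ : 0 < c ^ 2 - 2 * M * c + a ^ 2 := by nlinarith
  obtain ⟨hd1, hd3⟩ := photonOrbitRadius_neg_mem (x := -|a|) hM (by linarith [abs_nonneg a])
    (neg_nonpos.2 (abs_nonneg a))
  have hc3 : c < 3 * M := by linarith
  have hq := photonCubic_pos_of_lt_photonOrbitRadius_neg hM ha hMc hc₂
  have hc0 : 0 < c := by linarith
  -- `c² − 3Mc + 2a² < 0` on `(M, r_ph⁺)`, from `q(c) = (c − 3M)(c² − 3Mc + 2a²) − 2a²(c − M) > 0`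
  have hf : c ^ 2 - 3 * M * c + 2 * a ^ 2 < 0 := by
    by_contra h
    push Not at h
    nlinarith [mul_nonneg (by linarith : (0 : ℝ) ≤ 3 * M - c) h,
      mul_nonneg (sq_nonneg a) (by linarith : (0 : ℝ) ≤ c - M)]
  -- the symmetry `(E, L) ↦ (−E, −L)` lets us take `E ≥ 0`
  wlog hE : 0 ≤ E generalizing E L
  · have h := this (E := -E) (L := -L) (nullThetaAdmissible_neg_neg hadm)
      (by rcases hne with h | h | h <;> simp [h]) (by rwa [nullRadialPotential_neg_neg])
      (by linarith)
    rwa [nullRadialPotential_neg_neg] at h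
  rcases hE.eq_or_lt with hE0 | hEpos
  · -- `E = 0`: `R′ = −(2c − 2M)(Q + L²) < 0` (no root condition needed)
    subst hE0
    have hQ : 0 ≤ Q := hadm.carter_nonneg (by simpa using sq_nonneg L)
    have hK : 0 < Q + L ^ 2 := by
      rcases hne with h | h | h
      · exact absurd rfl h
      · have : 0 < L ^ 2 := lt_of_le_of_ne (sq_nonneg L) (Ne.symm (pow_ne_zero 2 h))
        linarith
      · have : 0 < Q := lt_of_le_of_ne hQ (Ne.symm h)
        nlinarith [sq_nonneg L]
    rw [deriv_nullRadialPotential]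
    have : (L - a * 0) ^ 2 = L ^ 2 := by ring
    rw [this]
    nlinarith [mul_pos (by linarith : (0 : ℝ) < 2 * c - 2 * M) hK]
  · have key := delta_mul_deriv_nullRadialPotential_of_eq_zero hroot
    -- it suffices that `PG < 0`
    suffices hPG : (E * c ^ 2 - a * (L - a * E)) *
        (E * c * (c ^ 2 - 3 * M * c + 2 * a ^ 2) + (c - M) * a * (L - a * E)) < 0 by
      have h2 : (c ^ 2 - 2 * M * c + a ^ 2) * deriv (nullRadialPotential M a E L Q) c < 0 := by
        rw [key]; linarith
      exact lt_of_mul_lt_mul_left (by rw [mul_zero]; exact h2) hΔ.le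
    rcases lt_trichotomy (E * c ^ 2 - a * (L - a * E)) 0 with hPneg | hP0 | hPpos
    · -- `P < 0` forces `G > 2EcΔ > 0`
      have hG : 0 < E * c * (c ^ 2 - 3 * M * c + 2 * a ^ 2) + (c - M) * a * (L - a * E) := by
        nlinarith [mul_pos (by linarith : (0 : ℝ) < c - M) (by linarith : 0 < a * (L - a * E) - E * c ^ 2),
          mul_pos (mul_pos hEpos hc0) hΔ]
      exact mul_neg_of_neg_of_pos hPneg hG
    · -- `P = 0` forces `K = 0` at a root, hence trivial constants
      exfalso
      have hP0' : E * (c ^ 2 + a ^ 2) - a * L = 0 := by linear_combination hP0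
      have hK : Q + (L - a * E) ^ 2 = 0 := by
        unfold nullRadialPotential at hroot
        rw [hP0'] at hroot
        have h0 : (c ^ 2 - 2 * M * c + a ^ 2) * (Q + (L - a * E) ^ 2) = 0 := by linarith
        rcases mul_eq_zero.1 h0 with h | h
        · linarith
        · exact h
      obtain ⟨hE0, -, -⟩ := hadm.trivial_of_P_eq_zero_of_K_eq_zero hc0.ne' hP0' hK
      linarith
    · -- `P > 0`: show `G < 0`
      suffices hG : E * c * (c ^ 2 - 3 * M * c + 2 * a ^ 2) + (c - M) * a * (L - a * E) < 0 from
        mul_neg_of_pos_of_neg hPpos hG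
      rcases lt_or_ge |L| (|a| * E) with hv | hnv
      · -- vortical-capable constants: `−2a²E < a(L − aE) < 0` and `c² − 3Mc + 2a² < 0`
        rcases eq_or_ne a 0 with ha0 | ha0
        · subst ha0; simp at hv; linarith [abs_nonneg L]
        have h1 : |a| * |L| < |a| * (|a| * E) := mul_lt_mul_of_pos_left hv (abs_pos.2 ha0)
        rw [← abs_mul, ← mul_assoc, abs_mul_abs_self, ← sq] at h1
        obtain ⟨haL1, haL2⟩ := abs_lt.1 h1
        nlinarith [mul_pos (mul_pos hEpos hc0) (by linarith : 0 < -(c ^ 2 - 3 * M * c + 2 * a ^ 2)),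
          mul_pos (by linarith : (0 : ℝ) < c - M) (by linarith : 0 < a ^ 2 * E - a * L)]
      · -- `L² ≥ a²E²`: `Q ≥ 0`, hence `N ≥ 0`
        have hQ : 0 ≤ Q := by
          refine hadm.carter_nonneg ?_
          have h1 : (|a| * E) ^ 2 ≤ |L| ^ 2 := pow_le_pow_left₀ (by positivity) hnv 2
          rwa [mul_pow, sq_abs, sq_abs] at h1
        have hN : 0 ≤ E ^ 2 * c ^ 3 - 2 * a * c * E * (L - a * E) -
            (c - 2 * M) * (L - a * E) ^ 2 := by
          have e : c * (E ^ 2 * c ^ 3 - 2 * a * c * E * (L - a * E) -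
              (c - 2 * M) * (L - a * E) ^ 2) = (c ^ 2 - 2 * M * c + a ^ 2) * Q := by
            unfold nullRadialPotential at hroot
            linear_combination hroot
          have : c * 0 ≤ c * (E ^ 2 * c ^ 3 - 2 * a * c * E * (L - a * E) -
              (c - 2 * M) * (L - a * E) ^ 2) := by
            rw [mul_zero, e]; exact mul_nonneg hΔ.le hQ
          exact le_of_mul_le_mul_left this hc0
        by_contra h
        push Not at h
        have hB2N := mul_nonneg (sq_nonneg ((c - M) * a)) hN
        have hcore : 0 < E ^ 2 * c ^ 2 * (c ^ 2 - 2 * M * c + a ^ 2) *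
            (c * (c - 3 * M) ^ 2 - 4 * M * a ^ 2) :=
          mul_pos (mul_pos (mul_pos (pow_pos hEpos 2) (pow_pos hc0 2)) hΔ) hq
        rcases le_or_gt (2 * M) c with h2M | h2M
        · -- `c ≥ 2M`: `Ñ` is concave; tangent bound at `t₀ = −EA`
          have expand : ((c - M) * a) ^ 2 *
                (E ^ 2 * c ^ 3 - 2 * a * c * E * (L - a * E) - (c - 2 * M) * (L - a * E) ^ 2) =
              -(E ^ 2 * c ^ 2 * (c ^ 2 - 2 * M * c + a ^ 2) * (c * (c - 3 * M) ^ 2 - 4 * M * a ^ 2)) +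
              2 * E * c * (c - 3 * M) * (c ^ 2 - 2 * M * c + a ^ 2) *
                (E * c * (c ^ 2 - 3 * M * c + 2 * a ^ 2) + (c - M) * a * (L - a * E)) -
              (c - 2 * M) *
                (E * c * (c ^ 2 - 3 * M * c + 2 * a ^ 2) + (c - M) * a * (L - a * E)) ^ 2 := by
            ring
          have hterm : 2 * E * c * (c - 3 * M) * (c ^ 2 - 2 * M * c + a ^ 2) *
              (E * c * (c ^ 2 - 3 * M * c + 2 * a ^ 2) + (c - M) * a * (L - a * E)) ≤ 0 := by
            have : 0 ≤ 2 * E * c * (3 * M - c) * (c ^ 2 - 2 * M * c + a ^ 2) *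
                (E * c * (c ^ 2 - 3 * M * c + 2 * a ^ 2) + (c - M) * a * (L - a * E)) :=
              mul_nonneg (mul_nonneg (mul_nonneg (by positivity) (by linarith)) hΔ.le) h
            linarith
          have hsq : 0 ≤ (c - 2 * M) *
              (E * c * (c ^ 2 - 3 * M * c + 2 * a ^ 2) + (c - M) * a * (L - a * E)) ^ 2 :=
            mul_nonneg (by linarith) (sq_nonneg _)
          linarith
        · -- `c < 2M`: `Ñ` is convex; chord bound between `t₀ = −EA` and `t₁ = (c − M)Ec²`
          have chord : ((E * c * (c ^ 2 - 3 * M * c + 2 * a ^ 2) + (c - M) * a * (L - a * E)) +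
                (c - M) * (E * c ^ 2 - a * (L - a * E))) * (((c - M) * a) ^ 2 *
                (E ^ 2 * c ^ 3 - 2 * a * c * E * (L - a * E) - (c - 2 * M) * (L - a * E) ^ 2)) =
              (c - M) * (E * c ^ 2 - a * (L - a * E)) *
                (-(E ^ 2 * c ^ 2 * (c ^ 2 - 2 * M * c + a ^ 2) * (c * (c - 3 * M) ^ 2 - 4 * M * a ^ 2))) +
              (E * c * (c ^ 2 - 3 * M * c + 2 * a ^ 2) + (c - M) * a * (L - a * E)) *
                (-((c - M) ^ 2 * E ^ 2 * c ^ 3 * (c ^ 2 - 2 * M * c + a ^ 2))) +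
              (c - 2 * M) * (E * c * (c ^ 2 - 3 * M * c + 2 * a ^ 2) + (c - M) * a * (L - a * E)) *
                ((c - M) * (E * c ^ 2 - a * (L - a * E))) *
                ((E * c * (c ^ 2 - 3 * M * c + 2 * a ^ 2) + (c - M) * a * (L - a * E)) +
                  (c - M) * (E * c ^ 2 - a * (L - a * E))) := by
            ring
          have hP' : 0 < (c - M) * (E * c ^ 2 - a * (L - a * E)) := mul_pos (by linarith) hPpos
          set G := E * c * (c ^ 2 - 3 * M * c + 2 * a ^ 2) + (c - M) * a * (L - a * E) with hG
          set P' := (c - M) * (E * c ^ 2 - a * (L - a * E)) with hP'def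
          set BN := ((c - M) * a) ^ 2 *
            (E ^ 2 * c ^ 3 - 2 * a * c * E * (L - a * E) - (c - 2 * M) * (L - a * E) ^ 2) with hBN
          have hlhs : 0 ≤ (G + P') * BN := mul_nonneg (by linarith) hB2N
          have h1 : P' * -(E ^ 2 * c ^ 2 * (c ^ 2 - 2 * M * c + a ^ 2) *
              (c * (c - 3 * M) ^ 2 - 4 * M * a ^ 2)) < 0 :=
            mul_neg_of_pos_of_neg hP' (neg_lt_zero.2 hcore)
          have h2 : G * -((c - M) ^ 2 * E ^ 2 * c ^ 3 * (c ^ 2 - 2 * M * c + a ^ 2)) ≤ 0 :=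
            mul_nonpos_of_nonneg_of_nonpos h (by
              have : 0 ≤ (c - M) ^ 2 * E ^ 2 * c ^ 3 * (c ^ 2 - 2 * M * c + a ^ 2) := by positivity
              linarith)
          have h3 : (c - 2 * M) * G * P' * (G + P') ≤ 0 := by
            have h4 : 0 ≤ G * P' * (G + P') := mul_nonneg (mul_nonneg h hP'.le) (by linarith)
            have e4 : (c - 2 * M) * G * P' * (G + P') = (c - 2 * M) * (G * P' * (G + P')) := by
              ring
            rw [e4]
            exact mul_nonpos_of_nonpos_of_nonneg (by linarith) h4
          linarith

end Literature.Geometry.Lorentzian.Kerr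

end
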